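import Summits.ResolutionOfSingularities.ResolutionOfSingularities.Theorems.HilbertSamuelEliminationSigmaMaxModificationsCorridor3TameWildDefs
import Literature.AlgebraicGeometry.Resolution.HilbertSamuelRegular
import Literature.AlgebraicGeometry.Resolution.HilbertSamuelValues
import Mathlib.RingTheory.Ideal.KrullsHeightTheorem
import Mathlib.AlgebraicGeometry.Noetherian
import HarnessLib

/-!
# Route `HilbertSamuelElimination`, crux `SigmaMaxModificationsCorridor3`
# (stmt-ResolutionOfSingularities-19249; child of `SigmaMaxModifications` stmt-…-18506),
# line `tame_wild` — the Hilbert–Samuel value IN DEGREE ONE: embedding dimension and `ψ`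

[OURS · L1 W4.2] Bookkeeping for the reduction "a maximal multiplicity-`2` hypersurface value has an
ISOLATED stratum" (landed `nuMod_dim_le_three_of_isMin_singular_value`, p461590, reduces it to: no
SINGULAR value of `H^3_Y` lies strictly below `hypersurfaceHF 2`). NOT a statement of any manuscript.

* (tree: `Scheme.hsFun_apply_one`, `H^N_Y(y)(1) = φ^N_Y(y) + emb.dim 𝒪_{Y,y}`, `φ = N − ψ`, CJS
  Def. 2.28; `Literature/AlgebraicGeometry/Resolution/HilbertSamuelValues.lean`.)
* `spanFinrank_eq_of_hsFun_one_le` — at a SINGULAR point `y` with `dim 𝒪_{Y,y} = d ≤ N` and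
  `H^N_Y(y)(1) ≤ N + 1`: `emb.dim 𝒪_{Y,y} = ψ_Y(y) + 1` and `d = ψ_Y(y)` (since
  `ψ ≤ d ≤ emb.dim`, and `emb.dim ≤ d` would make `𝒪_{Y,y}` regular). So a singular value `≤` the
  multiplicity-`2` hypersurface value `hypersurfaceHF 2` (whose degree-one entry is `4 = 3 + 1`,
  `hypersurfaceHF_two_apply_one`) is carried by an equidimensional point of embedding codimension one
  (`spanFinrank_eq_of_hsFun_le_hypersurfaceHF_two`) — the input of the ring-level step (Auslander–
  Buchsbaum + Hilbert function of a hypersurface) that remains for the classification.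

## Sources

* V. Cossart, U. Jannsen, S. Saito, LNM 2270 (2020), §2.2 (p. 27), Def. 2.28, Lemma 2.23.
  [CossartJannsenSaito2020]
-/

set_option linter.dupNamespace false -- mandated namespace of this single-conjunct summit

noncomputable section

open CategoryTheory AlgebraicGeometry TopologicalSpace Topology IsLocalRing
open Literature.AlgebraicGeometry.Resolution Literature.RingTheory.HilbertSamuel

namespace Summit.ResolutionOfSingularities.ResolutionOfSingularities.Theorems.SigmaMaxModificationsCorridor3.TameWild

/-! ## The Hilbert–Samuel value of a point in degree one -/

/-- **Embedding codimension one from the degree-one value.** At a SINGULAR point `y` of a locally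
Noetherian scheme with `dim 𝒪_{Y,y} = d ≤ N` and `H^N_Y(y)(1) ≤ N + 1`: `emb.dim 𝒪_{Y,y} = ψ_Y(y) + 1`
and `d = ψ_Y(y)`. Indeed `ψ ≤ d ≤ emb.dim` (minimal primes; Krull), `(N − ψ) + emb.dim ≤ N + 1` gives
`emb.dim ≤ ψ + 1`, and `emb.dim ≤ d` is excluded because it would make `𝒪_{Y,y}` regular.
[cite: CossartJannsenSaito2020, Def. 2.28, Lemma 2.23] -/
theorem spanFinrank_eq_of_hsFun_one_le {Y : Scheme.{0}} [IsLocallyNoetherian Y] {N : ℕ} {y : Y}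
    (hy : y ∉ Scheme.regularLocus Y) {d : ℕ} (hd : ringKrullDim (Y.presheaf.stalk y) = d)
    (hdN : d ≤ N) (h1 : Scheme.hsFun Y N y 1 ≤ N + 1) :
    (maximalIdeal (Y.presheaf.stalk y)).spanFinrank = Scheme.hsPsi Y y + 1 ∧
      d = Scheme.hsPsi Y y := by
  have hψd : Scheme.hsPsi Y y ≤ d := Scheme.hsPsi_le y hd
  have hde : d ≤ (maximalIdeal (Y.presheaf.stalk y)).spanFinrank := by
    have h := ringKrullDim_le_spanFinrank_maximalIdeal (Y.presheaf.stalk y)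
    rw [hd] at h
    exact_mod_cast h
  rw [Scheme.hsFun_apply_one, Scheme.hsPhi] at h1
  -- `emb.dim ≤ d` would make the local ring regular
  have hne : ¬ (maximalIdeal (Y.presheaf.stalk y)).spanFinrank ≤ d := by
    intro hle
    apply hy
    show IsRegularLocalRing (Y.presheaf.stalk y)
    apply IsRegularLocalRing.of_spanFinrank_maximalIdeal_le
    rw [hd]
    exact_mod_cast hle
  omega

/-! ## The multiplicity-`2` hypersurface value -/

/-- `hypersurfaceHF 2 1 = 4`: the degree-one entry of the multiplicity-`2` hypersurface value at
level `3` is `N + 1 = 4`. [cite: CossartJannsenSaito2020, Thm. 2.3] -/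
theorem hypersurfaceHF_two_apply_one : hypersurfaceHF 2 1 = 4 := by
  decide

/-- **A singular point whose level-`3` value is `≤ hypersurfaceHF 2` has embedding codimension one
and `dim 𝒪 = ψ`** (for `dim 𝒪_{Y,y} ≤ 3`): the scheme-side half of the classification "no singular
value lies strictly below the multiplicity-`2` hypersurface value"; the remaining half is ring theory
(a reduced quotient of a regular local ring of embedding codimension one with equidimensionality
`dim = ψ` is a hypersurface `R/(g)`, `ord g = m ≥ 2`, by Auslander–Buchsbaum, whose Hilbert function
`hypersurfaceHFe e m` dominates `hypersurfaceHFe e 2`). [cite: CossartJannsenSaito2020, Def. 2.28, Lemma 2.23] -/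
theorem spanFinrank_eq_of_hsFun_le_hypersurfaceHF_two {Y : Scheme.{0}} [IsLocallyNoetherian Y]
    {y : Y} (hy : y ∉ Scheme.regularLocus Y) {d : ℕ} (hd : ringKrullDim (Y.presheaf.stalk y) = d)
    (hd3 : d ≤ 3) (h : Scheme.hsFun Y 3 y ≤ hypersurfaceHF 2) :
    (maximalIdeal (Y.presheaf.stalk y)).spanFinrank = Scheme.hsPsi Y y + 1 ∧
      d = Scheme.hsPsi Y y :=
  spanFinrank_eq_of_hsFun_one_le hy hd hd3 (by simpa [hypersurfaceHF_two_apply_one] using h 1)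

end Summit.ResolutionOfSingularities.ResolutionOfSingularities.Theorems.SigmaMaxModificationsCorridor3.TameWild

end
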